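import Literature.NumberTheory.EllipticCurves.Kato2004.IwasawaH1LayerTorsionBoundProofs
import Summits.BirchSwinnertonDyer.BirchSwinnertonDyer.Theorems.ThetaPartnerAtTwoSignedTransportAtTwoResidualKummer
import HarnessLib

/-!
# Input (Λ2) of the `Λ`-adic road to SURJ⁺@2 (item 23110 at every rank): the layers `H¹(ℚ_n, T_pE)` are TORSION-FREE
# whenever `E(ℚ_∞)[p^∞] = 0` — in particular `H¹(ℚ_n, T₂E)` for `E` good supersingular at `2`, every `n`, every `ℤ₂`-extension

Routes `ResidualThetaTransportAtTwo` (RTT, crux r201 `ResidualLambdaFormulaNegDiscAtTwo`, stmt-BirchSwinnertonDyer-23110) /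
`ThetaPartnerAtTwo` (K1 `stub_surj2`). Seat `prover-bsd-rtt-w4` (width w4 of keying brief (195)); `--supports stmt-BirchSwinnertonDyer-23110`.
THEOREMS ONLY (no definition, no named fact, no `sorry`).

WHY. The tower-vanishing lemma (`ResidualThetaLayer.TowerVanishing.forall_eq_zero_of_antitone_of_rank_le_of_smul_mem`, this seat)
kills the universal-norm compact `+` Selmer group `𝔖⁺_∞ = lim← 𝔖⁺(E/ℚ_m)` — whence SURJ⁺@2 by Poitou–Tate at the layers — provided
the LAYERS `𝔖⁺(E/ℚ_m) ⊂ H¹(ℚ_m, T₂E)` are torsion-free `ℤ₂`-modules (its counterexample `Λ/(2^m T, ω_m)` shows the hypothesis is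
needed). The tree has the UNIFORM torsion bound `∃ c, p^c · H¹(ℚ_n, T_pW)[p^∞] = 0` for every `E/ℚ`
(`IwasawaH1LayerNorm.exists_forall_pow_smul_eq_zero_of_pow_smul_eq_zero`, from the finiteness of `E(ℚ_∞)[p^∞]`); THIS FILE is its
`c = 0` case under `E(ℚ_∞)[p^∞] = 0`, by the same cochain argument (`p^k φ = ∂m`, `m mod p^k ∈ W[p^k]^{Γ_n} ⊆ E(ℚ_∞)[p^∞] = 0`, so
`m = p^k b` and `φ = ∂b`):

* `layerH1_eq_zero_of_pow_smul_eq_zero_of_fixedPoints_eq_bot` — every `E/ℚ`, prime `p`, `ℤ_p`-extension `κ` with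
  `E[p^∞]^{Gal(ℚ̄/ℚ_∞)} = 0`: for all `n, k` and `y ∈ H¹(ℚ_n, T_pW)`, `p^k • y = 0 → y = 0`;
* `layerH1_eq_zero_of_pow_smul_eq_zero_of_goodSS` — `p = 2`, `E` globally minimal with good supersingular reduction at `2`
  (`W(ℚ_∞)[2^∞] = 0`: `SignedTransportAtTwo.fixedPoints_kerSubgroup_eq_bot_of_goodSS`), every `ℤ₂`-extension, every layer.

HONEST FRAMING: closes nothing; BSD is not proved by any of this.
References: [GreenbergLNM1716] §1 p. 62, §3 p. 86; [Rubin2000] App. B §2 (`H¹(K,T)_{tors} = image of H⁰(K, W[p^∞])`);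
[Kato2004Asterisque] §13.8 (p. 228); [GreenbergVatsal2000] §2 Prop. (2.1).
-/

set_option autoImplicit false
-- D-0017: single-problem summit, so `Summit.BirchSwinnertonDyer.BirchSwinnertonDyer.…` repeats a namespace BY DESIGN.
set_option linter.dupNamespace false

noncomputable section

open scoped NumberField
open Field CategoryTheory
open Literature.NumberTheory.GaloisRepresentations
open Literature.NumberTheory.EllipticCurves Literature.NumberTheory.EllipticCurves.Kato2004
open Literature.NumberTheory.EllipticCurves.Kato2004.EulerSystemValues
open Literature.NumberTheory.EllipticCurves.Kato2004.IwasawaH1LayerNorm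
open WeierstrassCurve (geomPoints geomTorsion geomPrimaryTorsion)

namespace Summit.BirchSwinnertonDyer.BirchSwinnertonDyer.Theorems.ResidualThetaLayer.TowerVanishing

variable {p : ℕ} [hp : Fact p.Prime] (W : WeierstrassCurve ℚ) [W.IsElliptic]
  [ContinuousSMul ℤ_[p] (W.tateModule p)] (κ : ZpExtension ℚ p)

/-- **`H¹(ℚ_n, T_pW)` is torsion-free when `E(ℚ_∞)[p^∞] = 0`.** For every elliptic curve `E/ℚ`, prime `p` and `ℤ_p`-extension
`κ` of `ℚ` such that `E[p^∞]` has no non-zero point fixed by `Gal(ℚ̄/ℚ_∞)`: for every layer `n`, every `k` and every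
`y ∈ H¹(ℚ_n, T_pW)`, `p^k • y = 0 → y = 0`. On cochains: `p^k φ = ∂m`; `m mod p^k ∈ W[p^k]` is fixed by `Γ_n ⊇ Gal(ℚ̄/ℚ_∞)`, hence
`0`; so `m = p^k b` (`exists_pow_smul_eq_of_proj_eq_zero`) and `φ = ∂b` after cancelling `p^k` in the torsion-free `T_pW`
(`eq_of_pow_smul_eq`). The `c = 0` case of the tree's uniform bound `exists_forall_pow_smul_eq_zero_of_pow_smul_eq_zero`.
[cite: Rubin2000, App. B §2] [cite: GreenbergLNM1716, §1 p. 62 and §3 p. 86] [cite: Kato2004Asterisque, §13.8 (p. 228)] -/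
theorem layerH1_eq_zero_of_pow_smul_eq_zero_of_fixedPoints_eq_bot
    (hfix : FixedPoints.addSubgroup κ.kerSubgroup (↥(W.geomPrimaryTorsion p)) = ⊥)
    (n k : ℕ) (y : H1 (tateRep W p) (κ.layerSubgroup n)) (hy : ((p : ℤ_[p]) ^ k) • y = 0) : y = 0 := by
  obtain ⟨φ, rfl⟩ := oneCocycleClass_surjective _ y
  -- the action of `Γ_n` on `T_pW|_{Γ_n}` is the Galois action
  have hρ : ∀ (g : κ.layerSubgroup n) (a : W.tateModule p),
      (subgroupRep (tateRep W p).toTopRep (κ.layerSubgroup n)).ρ g a = (g : absoluteGaloisGroup ℚ) • a := fun g a => rfl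
  -- `p^k φ = ∂m`
  rw [← oneCocycleClass_smul, oneCocycleClass_eq_zero_iff] at hy
  obtain ⟨m, hm⟩ := hy
  have hm' : ∀ g : κ.layerSubgroup n,
      p ^ k • (φ.1 g : W.tateModule p) = (g : absoluteGaloisGroup ℚ) • m - m := fun g => by
    have h := hm g
    rw [Submodule.coe_smul, ContinuousMap.smul_apply, ← Nat.cast_pow, Nat.cast_smul_eq_nsmul, hρ] at h
    exact h
  -- `m mod p^k` is `Γ_n`-fixed, hence `Gal(ℚ̄/ℚ_∞)`-fixed, hence `0`
  have hfixk : ∀ g ∈ κ.layerSubgroup n, g • tateModPk W p k m = tateModPk W p k m := by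
    intro g hg
    have hgm : g • m = p ^ k • (φ.1 ⟨g, hg⟩ : W.tateModule p) + m := sub_eq_iff_eq_add.mp (hm' ⟨g, hg⟩).symm
    rw [← tateModPk_smul]
    apply Subtype.ext
    rw [coe_tateModPk_apply, coe_tateModPk_apply, hgm, map_add, map_nsmul, TateModule.pow_smul_proj, zero_add]
  have hvP : ((tateModPk W p k m : geomTorsion W ((p : ℤ) ^ k)) : geomPoints W) ∈ geomPrimaryTorsion W p := by
    refine AddCommGroup.mem_primaryComponent.mpr ⟨k, ?_⟩
    have h := (Submodule.mem_torsionBy_iff _ _).mp (tateModPk W p k m).2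
    rwa [← natCast_zsmul, Nat.cast_pow]
  have hzero : ((tateModPk W p k m : geomTorsion W ((p : ℤ) ^ k)) : geomPoints W) = 0 := by
    have hmem : (⟨_, hvP⟩ : ↥(W.geomPrimaryTorsion p)) ∈
        FixedPoints.addSubgroup κ.kerSubgroup (↥(W.geomPrimaryTorsion p)) := by
      rw [FixedPoints.mem_addSubgroup]
      intro τ
      apply Subtype.ext
      rw [Subgroup.mk_smul, primaryComponent.coe_smul]
      change (τ : absoluteGaloisGroup ℚ) • ((tateModPk W p k m : geomTorsion W ((p : ℤ) ^ k)) : geomPoints W) = _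
      rw [← AddSubgroup.torsionBy.coe_smul, hfixk _ (κ.kerSubgroup_le_layerSubgroup n τ.2)]
    rw [hfix, AddSubgroup.mem_bot] at hmem
    exact congrArg Subtype.val hmem
  have hck : TateModule.proj p k m = 0 := by rwa [coe_tateModPk_apply] at hzero
  -- `m = p^k b`
  obtain ⟨b, hb⟩ := exists_pow_smul_eq_of_proj_eq_zero W k m hck
  -- `φ = ∂b` after cancelling `p^k`
  have hgb : ∀ g : κ.layerSubgroup n,
      (g : absoluteGaloisGroup ℚ) • (p ^ k • b) = p ^ k • ((g : absoluteGaloisGroup ℚ) • b) := fun g => smul_comm _ _ _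
  have hφ : ∀ g : κ.layerSubgroup n, (φ.1 g : W.tateModule p) = (g : absoluteGaloisGroup ℚ) • b - b := fun g => by
    apply eq_of_pow_smul_eq W k
    rw [hm' g, ← hb, hgb g, nsmul_sub]
  rw [oneCocycleClass_eq_zero_iff]
  refine ⟨b, fun g => ?_⟩
  rw [hρ]
  exact hφ g

/-- **At `p = 2` on the supersingular rows: `H¹(ℚ_n, T₂E)` is torsion-free at every layer of every `ℤ₂`-extension.** For `E/ℚ`
globally minimal with good supersingular reduction at `2` (`W(ℚ_∞)[2^∞] = 0` by
`SignedTransportAtTwo.fixedPoints_kerSubgroup_eq_bot_of_goodSS`): `2^k • y = 0 → y = 0` in `H¹(ℚ_n, T₂E)`. This is input (Λ2)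
(torsion-free layers) of the `Λ`-adic road to SURJ⁺@2 for the compact `+` Selmer tower `𝔖⁺(E/ℚ_n) ⊂ H¹(ℚ_n, T₂E)`.
[cite: GreenbergVatsal2000, §2 Prop. (2.1)] [cite: GreenbergLNM1716, §1 p. 62] -/
theorem layerH1_eq_zero_of_pow_smul_eq_zero_of_goodSS {W : WeierstrassCurve ℚ} [W.IsElliptic] [W.IsGloballyMinimal]
    [ContinuousSMul ℤ_[2] (W.tateModule 2)] (hss : Rank1Residual.GoodSS W 2) (κ : ZpExtension ℚ 2)
    (n k : ℕ) (y : H1 (tateRep W 2) (κ.layerSubgroup n)) (hy : ((2 : ℤ_[2]) ^ k) • y = 0) : y = 0 :=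
  layerH1_eq_zero_of_pow_smul_eq_zero_of_fixedPoints_eq_bot (p := 2) W κ
    (SignedTransportAtTwo.fixedPoints_kerSubgroup_eq_bot_of_goodSS W hss κ) n k y (by exact_mod_cast hy)

end Summit.BirchSwinnertonDyer.BirchSwinnertonDyer.Theorems.ResidualThetaLayer.TowerVanishing

end
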